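import Summits.QuantumFields.BalabanUV.Beta.GAN24.MonotoneMultiplier
import Summits.QuantumFields.BalabanUV.Beta.GAN24.WoodburyFibreAssembly

/-!
# Beta / GAN24 / MonotoneAssembly — the β-side END of road P4 with the resolvent slot SPLIT INTO BLOCKS: the multiplier third supplied by the monotone road
# (p3's dictionary + ONE diagonal datum, NO rate), the field blocks as ONE named residual — the monotone twin of p3's `WoodburyFibre.convCResolvent_of_multDict_of_fieldBlocksRate`
# (gan24-p4 gen 2, node P4-N9 glue of `HOME/b2b-balaban-gan24-p4/SKELETON-P4.md`; BINDER-OWNERS row G-an2-4 ∕ (CONV-C); NOT IN PRINT — our proof attempt)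

HONEST FRAMING (page 1 of everything the β sub-cell writes): discharging `BetaPertH` makes Bałaban's UV stability UNCONDITIONAL — a
real constructive-QFT result; it is NOT the continuum limit and NOT the Clay problem.  HONEST DEPENDENCY (cell reorg 2026-08-19, verbatim):
«continuum YM on T⁴ ⇐ BetaPertH ∧ nine spine estimates (0/9 proved); BetaPertH ⇐ (D1) ∧ (D4) ∧ CAP+tail; G-an2-4 gates asym, D1 and NE2/3/4.»
HONEST LABEL: «not in print; our proof attempt; alternative discharge of the G-an2-4 row (rate OR monotonicity)»; 0 wall binders instantiated.
ABSOLUTE RULE honoured: the one `def … : Prop` (`FieldBlocksBand`) is a BINDER SHAPE asserted of nothing; everything else is [folklore] bookkeeping over gen 1's END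
`MonotoneCauchy.betaAvgAFH_of_rows_supCauchyBand`, p3's block split `WoodburyFibreBlocks` ∕ `WoodburyFibre.decays_blockMM_of_multDict`, and `MonotoneMultiplier` BY NAME.

WHAT IS PROVED.  §1 `supBound_add`, `supCauchyBand_add` (bands add over a sum of kernel families).  §2 [shape] `FieldBlocksBand Lc C δK η k₀` := uniform decay of the FIELD blocks
`blockF K_j^{(1)}` ∧ their sup-Cauchy band from `k₀` (the RESIDUAL of the monotone road: transverse part ⇐ `MonotoneCoarsenReadOut` in the test-form currency, pure-gauge part = §5 of the
skeleton); `slot_decays_of_multDict_of_fieldBand`, `slot_supCauchyBand_of_multDict_of_fieldBand`: `MultDict Lc c` + the mm datum + `FieldBlocksBand` ⟹ both rows for the WHOLE slot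
`unitResolvent Lc j` (uniform `Decays` with constant `C + |c|·c166Z 3`; `SupCauchyBand` with `η + |c|·η₀`).  §3 **`betaAvgAFH_of_rows_multDict_fieldBand`**: an5's rows × row D1's dictionary
`hβ` for the slot `unitResolvent Lc` × `MultDict` × mm datum × `FieldBlocksBand` × jets × `RemainderConst` ⟹ `BetaAvgAFH (min m₀ (m − cauchyConst …) − r) 0 γ₀ β` — gen 1's END BY NAME.
NOT BetaPertH, NOT continuum, NOT Clay.
-/

noncomputable section

open Literature.MathematicalPhysics.QuantumFieldTheory.Balaban1983to89
open Literature.MathematicalPhysics.QuantumFieldTheory.Balaban1983to89.Beta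
open FlowStep
open B12Beta (secondMoment)
open ExpKernelCalculus (MKer Decays VertexFamily VertexFamily₂ hessKer)
open OneStepResolventKernel (Fib)
open Beta.RemainderChain (RemainderConst)
open Beta.AveragedAFCarrier (BetaAvgAFH)
open Summit.QuantumFields.BalabanUV.Beta.CapRows
open Summit.QuantumFields.BalabanUV.Beta.GAN24.CombesThomas (SupBound)
open Summit.QuantumFields.BalabanUV.Beta.GAN24.MonotoneCauchy (SupCauchyBand cauchyConst betaAvgAFH_of_rows_supCauchyBand)
open Summit.QuantumFields.BalabanUV.Beta.PropagatorWoodburyFibreTarget (unitResolvent)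
open Summit.QuantumFields.BalabanUV.Beta.GAN24.WoodburyFibreBlocks (blockF blockMM blockF_add_blockMM blockF_sub blockMM_sub decays_add decays_of_blockF_blockMM)
open Summit.QuantumFields.BalabanUV.Beta.GAN24.WoodburyFibre (MultDict decays_blockMM_of_multDict c166Z_nonneg)
open Summit.QuantumFields.BalabanUV.Beta.GAN24.DirichletExhaustionDeltaZ (c166Z kappaZ)
open Summit.QuantumFields.BalabanUV.Beta.GAN24.MonotoneMultiplier (dDiag dSup supCauchyBand_blockMM_of_multDict_sup)

namespace Summit.QuantumFields.BalabanUV.Beta.GAN24.MonotoneAssembly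

/-! ## §1 Bands add -/

section Add

variable {D : ℕ} {F : Type*}

/-- Sup bounds add. [folklore] -/
theorem supBound_add {X Y : MKer D F} {ε ε' : ℝ} (hX : SupBound X ε) (hY : SupBound Y ε') : SupBound (X + Y) (ε + ε') := fun x y a b =>
  (abs_add_le _ _).trans (add_le_add (hX x y a b) (hY x y a b))

/-- Sup-Cauchy bands add over a sum of kernel families. [folklore] -/
theorem supCauchyBand_add {A B : ℕ → MKer D F} {η η' : ℝ} {k₀ : ℕ} (hA : SupCauchyBand A η k₀) (hB : SupCauchyBand B η' k₀) :
    SupCauchyBand (fun j => A j + B j) (η + η') k₀ := by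
  intro j j' hj hj'
  have e : (A j + B j) - (A j' + B j') = (A j - A j') + (B j - B j') := by abel
  rw [e]
  exact supBound_add (hA j j' hj hj') (hB j j' hj hj')

end Add

/-! ## §2 The residual shape and the two rows for the whole slot -/

section Slot

variable {Lc : ℕ} [NeZero Lc]

/-- [shape] **THE FIELD-BLOCK RESIDUAL OF THE MONOTONE ROAD `FieldBlocksBand Lc C δK η k₀`**: `j`-uniform decay of the field blocks `blockF K_j^{(1)}` (= (I3), shared with road P1 Part A)
∧ their sup-Cauchy band `η` from `k₀` (transverse part: `MonotoneCoarsenReadOut` in the test-form currency; pure-gauge part: §5 of SKELETON-P4, not monotone at the first steps).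
The monotone twin of p3's `FieldBlocksRate` (band in place of the all-scales rate).  A binder shape asserted of nothing; never a fact. -/
def FieldBlocksBand (Lc : ℕ) [NeZero Lc] (C δK η : ℝ) (k₀ : ℕ) : Prop :=
  (∀ j, Decays (blockF (unitResolvent Lc j)) C δK) ∧ SupCauchyBand (fun j => blockF (unitResolvent Lc j)) η k₀

/-- **UNIFORM DECAY OF THE WHOLE SLOT from the dictionary and the residual** (`δK ≤ kappaZ 3/(4Lc)`): constant `C + |c|·c166Z 3`, rate `δK`. [folklore] -/
theorem slot_decays_of_multDict_of_fieldBand {c C δK η : ℝ} {k₀ : ℕ} (hdict : MultDict Lc c) (hF : FieldBlocksBand Lc C δK η k₀)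
    (hδ : δK ≤ kappaZ 3 / (4 * Lc)) : ∀ j, Decays (unitResolvent Lc j) (C + |c| * c166Z 3) δK := fun j =>
  decays_of_blockF_blockMM (hF.1 j)
    (OneStepResolventKernel.decays_mono (decays_blockMM_of_multDict hdict j) (mul_nonneg (abs_nonneg c) c166Z_nonneg) le_rfl hδ)

/-- **THE SUP-CAUCHY BAND OF THE WHOLE SLOT from the dictionary, ONE mm datum and the residual**: `η + |c|·η₀` from `k₀`, NO rate. [folklore] -/
theorem slot_supCauchyBand_of_multDict_of_fieldBand {c C δK η η₀ : ℝ} {k₀ : ℕ} (hdict : MultDict Lc c) (hF : FieldBlocksBand Lc C δK η k₀)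
    (hdat : ∀ κ : Fin (3 + 1), dSup (d := 3) Lc κ - dDiag Lc (k₀ + 1) κ ≤ η₀) :
    SupCauchyBand (fun j => unitResolvent Lc j) (η + |c| * η₀) k₀ := by
  have h := supCauchyBand_add hF.2 (supCauchyBand_blockMM_of_multDict_sup hdict hdat)
  have e : (fun j => blockF (unitResolvent Lc j) + blockMM (unitResolvent Lc j)) = fun j => unitResolvent Lc j :=
    funext fun j => blockF_add_blockMM _
  rwa [e] at h

end Slot

/-! ## §3 The β-side END of road P4 with the resolvent slot split into blocks -/

section End

variable {Lc : ℕ} [NeZero Lc] {β : HBeta}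
variable {V : ℕ → Fin (3 + 1) → ExpKernelCalculus.Site (3 + 1) → MKer (3 + 1) (Fib 3)}
  {W : ℕ → Fin (3 + 1) → ExpKernelCalculus.Site (3 + 1) → Fin (3 + 1) → ExpKernelCalculus.Site (3 + 1) → MKer (3 + 1) (Fib 3)}
  {C Cv Cw εV εW δK c η η₀ : ℝ} {N k₀ : ℕ} {μ ν : Fin (3 + 1)}

/-- **THE β-SIDE END OF ROAD P4, RESOLVENT THIRD SPLIT** (node P4-N9 glue): an5's certified rows `c : CapRows.Rows S.β0` × row D1's dictionary `hβ` for the one-step-normalised slot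
`unitResolvent Lc j` × p3's `MultDict Lc c` × ONE mm datum `dSup − dDiag (k₀+1) ≤ η₀` × the field-block residual `FieldBlocksBand Lc C δK η k₀` (`δK ≤ kappaZ 3/(4Lc)`) × jet data ×
`RemainderConst` ⟹ `BetaAvgAFH (min m₀ (m − cauchyConst 4 |Fib 3| δK (C + |c|·c166Z 3) Cv Cw (η + |c|·η₀) εV εW) − r) 0 γ₀ β` — gen 1's `betaAvgAFH_of_rows_supCauchyBand` BY NAME.
CONDITIONAL on the named binders; 0 instantiated. [folklore] -/
theorem betaAvgAFH_of_rows_multDict_fieldBand (S : B12Beta.OneLoopSplit β) (cr : Rows S.β0)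
    (hβ : ∀ j, S.β0 j = secondMoment (hessKer (unitResolvent Lc j) (V j) (W j)) μ ν)
    (hdict : MultDict Lc c) (hdat : ∀ κ : Fin (3 + 1), dSup (d := 3) Lc κ - dDiag Lc (k₀ + 1) κ ≤ η₀) (hη₀ : 0 ≤ η₀)
    (hF : FieldBlocksBand Lc C δK η k₀) (hC : 0 ≤ C) (hη : 0 ≤ η) (hδ : δK ≤ kappaZ 3 / (4 * Lc)) (hδ0 : 0 < δK) (hk₀ : k₀ ≤ cr.k₀)
    (hV : ∀ j, VertexFamily (V j) N Cv (δK / 2)) (hW : ∀ j, VertexFamily₂ (W j) N Cw (δK / 2))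
    (hVdev : ∀ j j', k₀ ≤ j → k₀ ≤ j' → VertexFamily (V j - V j') N εV (δK / 2))
    (hWdev : ∀ j j', k₀ ≤ j → k₀ ≤ j' → VertexFamily₂ (W j - W j') N εW (δK / 2))
    (hN : 1 ≤ N) {γ₀ r : ℝ} (hrem : RemainderConst S γ₀ r) :
    BetaAvgAFH (min ((cr.m₀ : ℚ) : ℝ) ((cr.m : ℚ) -
      cauchyConst (3 + 1) (Fintype.card (Fib 3)) δK (C + |c| * c166Z 3) Cv Cw (η + |c| * η₀) εV εW) - r) 0 γ₀ β :=
  betaAvgAFH_of_rows_supCauchyBand S cr hβ (slot_decays_of_multDict_of_fieldBand hdict hF hδ)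
    (add_nonneg hC (mul_nonneg (abs_nonneg c) c166Z_nonneg)) (slot_supCauchyBand_of_multDict_of_fieldBand hdict hF hdat)
    (add_nonneg hη (mul_nonneg (abs_nonneg c) hη₀)) hk₀ hV hW hVdev hWdev hδ0 hN hrem

end End

/-! ## §4 (v1.1, append-only + one import) The multiplier dictionary DISCHARGED BY NAME (gan24-p3's `WoodburyFibreAssembly.multDict_holds`,
`c = 2·Lc⁻⁸`): the mm block of the wall's slot satisfies (MONO-K)₂ from ONE diagonal datum UNCONDITIONALLY, and the END needs only the datum + the residual -/

section Unconditional

open Summit.QuantumFields.BalabanUV.Beta.GAN24.WoodburyFibreAssembly (multDict_holds)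

variable {Lc : ℕ} [NeZero Lc]

/-- **(MONO-K)₂ FOR THE MULTIPLIER BLOCK OF THE WALL'S SLOT — UNCONDITIONAL BUT FOR THE DATUM**: ONE diagonal datum
`dSup Lc κ − dDiag Lc (k₀+1) κ ≤ η₀` (all `κ`) ⟹ `SupCauchyBand (j ↦ blockMM (unitResolvent Lc j)) (|2·Lc⁻⁸|·η₀) k₀`; NO rate, NO symbolic constant, NO
hypothesis on the typed system (`MonotoneMultiplier.supCauchyBand_blockMM_of_multDict_sup` at `multDict_holds`). [folklore] -/
theorem supCauchyBand_blockMM_of_datum {k₀ : ℕ} {η₀ : ℝ} (hdat : ∀ κ : Fin (3 + 1), dSup (d := 3) Lc κ - dDiag Lc (k₀ + 1) κ ≤ η₀) :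
    SupCauchyBand (fun j => blockMM (unitResolvent Lc j)) (|2 * ((Lc : ℝ) ^ 8)⁻¹| * η₀) k₀ :=
  supCauchyBand_blockMM_of_multDict_sup (multDict_holds Lc) hdat

variable {β : HBeta}
variable {V : ℕ → Fin (3 + 1) → ExpKernelCalculus.Site (3 + 1) → MKer (3 + 1) (Fib 3)}
  {W : ℕ → Fin (3 + 1) → ExpKernelCalculus.Site (3 + 1) → Fin (3 + 1) → ExpKernelCalculus.Site (3 + 1) → MKer (3 + 1) (Fib 3)}
  {C Cv Cw εV εW δK η η₀ : ℝ} {N k₀ : ℕ} {μ ν : Fin (3 + 1)}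

/-- **THE β-SIDE END OF ROAD P4, MULTIPLIER THIRD DISCHARGED**: as `betaAvgAFH_of_rows_multDict_fieldBand` WITHOUT the `MultDict` hypothesis (`c = 2·Lc⁻⁸` by
gan24-p3's theorem): rows × `hβ` × ONE mm datum × `FieldBlocksBand` residual × jets × `RemainderConst` ⟹ the (R15) carrier.  CONDITIONAL on the named binders
(`hβ` = row D1; `FieldBlocksBand` = (I3) + the field-block band; the datum = an engine certificate); 0 instantiated. [folklore] -/
theorem betaAvgAFH_of_rows_fieldBand (S : B12Beta.OneLoopSplit β) (cr : Rows S.β0)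
    (hβ : ∀ j, S.β0 j = secondMoment (hessKer (unitResolvent Lc j) (V j) (W j)) μ ν)
    (hdat : ∀ κ : Fin (3 + 1), dSup (d := 3) Lc κ - dDiag Lc (k₀ + 1) κ ≤ η₀) (hη₀ : 0 ≤ η₀)
    (hF : FieldBlocksBand Lc C δK η k₀) (hC : 0 ≤ C) (hη : 0 ≤ η) (hδ : δK ≤ kappaZ 3 / (4 * Lc)) (hδ0 : 0 < δK) (hk₀ : k₀ ≤ cr.k₀)
    (hV : ∀ j, VertexFamily (V j) N Cv (δK / 2)) (hW : ∀ j, VertexFamily₂ (W j) N Cw (δK / 2))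
    (hVdev : ∀ j j', k₀ ≤ j → k₀ ≤ j' → VertexFamily (V j - V j') N εV (δK / 2))
    (hWdev : ∀ j j', k₀ ≤ j → k₀ ≤ j' → VertexFamily₂ (W j - W j') N εW (δK / 2))
    (hN : 1 ≤ N) {γ₀ r : ℝ} (hrem : RemainderConst S γ₀ r) :
    BetaAvgAFH (min ((cr.m₀ : ℚ) : ℝ) ((cr.m : ℚ) -
      cauchyConst (3 + 1) (Fintype.card (Fib 3)) δK (C + |2 * ((Lc : ℝ) ^ 8)⁻¹| * c166Z 3) Cv Cw (η + |2 * ((Lc : ℝ) ^ 8)⁻¹| * η₀) εV εW) - r)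
      0 γ₀ β :=
  betaAvgAFH_of_rows_multDict_fieldBand S cr hβ (multDict_holds Lc) hdat hη₀ hF hC hη hδ hδ0 hk₀ hV hW hVdev hWdev hN hrem

end Unconditional

end Summit.QuantumFields.BalabanUV.Beta.GAN24.MonotoneAssembly

end
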